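import Mathlib
import HarnessLib
import Literature.NumberTheory.GaloisRepresentations.WeilDeligneRep
import Literature.NumberTheory.GaloisRepresentations.WeilGroupFrobeniusPowers
import Literature.NumberTheory.GaloisRepresentations.LocalGaloisGroupFrobeniusProofs
import Literature.NumberTheory.Automorphic.AdicCompletionLocalField
set_option linter.dupNamespace false
set_option linter.unusedVariables false
set_option linter.unusedSectionVars false

/-!
# NonIwahoriBlockMatchingTraceOffInertia — trace-off-inertia rigidity

LANDING COPY (lens-2 g25 instrument I-g25.1): `ledger propose --kind proof --target Summits/Langlands/Langlands/Theorems/NonIwahoriBlockMatchingTraceOffInertia.lean --supports stmt-Langlands-28114`.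
Closes the registered stub `stub_toir` of `Cruxes/NonIwahoriBlockMatching/Lines/birth.lean` and the PROVED lemma `toir_holds` of `Lines/abelian-parameter.lean`.

Kernel proof of the registered stub `stub_toir` of the birth skeleton of crux
`IwahoriBlockSplit.NonIwahoriBlockMatching` (stmt-Langlands-28114, `Cruxes/NonIwahoriBlockMatching/Lines/birth.lean`):
two representations of the Weil group `W_F` of a non-archimedean local field on the same finite free module whose
traces agree OFF the inertia group `I_F` have equal traces everywhere.

Proof (pure linear algebra; no continuity, no monodromy).  Fix `w ∈ I_F` and an arithmetic Frobenius lift `Φ`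
(`deg Φ = 1`, `WeilGroup.deg_surjective`).  For `k ≥ 1`, `deg (Φ^k w) = k ≠ 0`, so `Φ^k w ∉ I_F` and
`tr ρ(Φ)^k ρ(w) = tr ρ'(Φ)^k ρ'(w)`.  Let `p = χ_{ρ(Φ)} · χ_{ρ'(Φ)}` (product of the characteristic polynomials);
Cayley–Hamilton gives `p(ρ Φ) = 0 = p(ρ' Φ)`, and `p(0) ≠ 0` since `ρ(Φ), ρ'(Φ)` are invertible.  Writing
`p = X·q + p(0)` we get `p(0)·ρ(w) = -ρ(Φ) q(ρ Φ) ρ(w)`, whose trace is a `ℂ`-combination of the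
`tr ρ(Φ)^{k+1} ρ(w)`, hence equal to the primed one; cancel `p(0)`.
Refs: the standard argument that traces on `W_F ∖ I_F` determine the semisimplified Weil representation
(Deligne, Antwerp II (1973) §8; Tate, Corvallis (1979) (4.1.3)). [cite: TateCorvallis1979, (4.1.3)]
-/

open Polynomial

namespace Summit.Langlands.Langlands.Theorems.NonIwahoriBlockMatchingTraceOffInertia

open Literature.NumberTheory.GaloisRepresentations

section General

variable {C : Type*} [Field C] {V : Type*} [AddCommGroup V] [Module C V]

/-- Auxiliary: for every polynomial `q`, `tr (A · q(A) · B) = tr (A' · q(A') · B')` as soon as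
`tr (A^(k+1) B) = tr (A'^(k+1) B')` for all `k`. -/
theorem trace_mul_aeval_mul_eq (A A' B B' : Module.End C V)
    (h : ∀ k : ℕ, LinearMap.trace C V (A ^ (k + 1) * B) = LinearMap.trace C V (A' ^ (k + 1) * B'))
    (q : C[X]) :
    LinearMap.trace C V (A * aeval A q * B) = LinearMap.trace C V (A' * aeval A' q * B') := by
  induction q using Polynomial.induction_on' with
  | add p q hp hq =>
      simp only [map_add, mul_add, add_mul, hp, hq]
  | monomial k c =>
      have e : ∀ (X' Y : Module.End C V), X' * aeval X' (monomial k c) * Y = c • (X' ^ (k + 1) * Y) := by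
        intro X' Y
        rw [aeval_monomial, Algebra.algebraMap_eq_smul_one, smul_mul_assoc, one_mul, mul_smul_comm,
          smul_mul_assoc, ← pow_succ']
      rw [e, e, map_smul, map_smul, h k]

/-- Auxiliary (Cayley–Hamilton cancellation): if `p(X') = 0` then `p(0) • Y = -(X' · (p div X)(X') · Y)`. -/
theorem coeff_zero_smul_eq_of_aeval_eq_zero (p : C[X]) (X' Y : Module.End C V) (hX : aeval X' p = 0) :
    (p.coeff 0) • Y = -(X' * aeval X' (divX p) * Y) := by
  have e := congrArg (aeval X') (X_mul_divX_add p)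
  rw [hX, map_add, map_mul, aeval_X, aeval_C, Algebra.algebraMap_eq_smul_one] at e
  have e2 : (p.coeff 0) • (1 : Module.End C V) = -(X' * aeval X' (divX p)) :=
    eq_neg_of_add_eq_zero_right e
  calc (p.coeff 0) • Y = ((p.coeff 0) • (1 : Module.End C V)) * Y := by rw [smul_mul_assoc, one_mul]
    _ = -(X' * aeval X' (divX p)) * Y := by rw [e2]
    _ = -(X' * aeval X' (divX p) * Y) := by rw [neg_mul]

variable [Module.Free C V] [Module.Finite C V]

/-- Linear-algebra core: if `A, A'` are invertible endomorphisms of a finite free module and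
`tr (A^(k+1) B) = tr (A'^(k+1) B')` for all `k ≥ 0`, then `tr B = tr B'`. -/
theorem trace_eq_of_trace_pow_mul_eq (A A' B B' : Module.End C V) (hA : IsUnit A) (hA' : IsUnit A')
    (h : ∀ k : ℕ, LinearMap.trace C V (A ^ (k + 1) * B) = LinearMap.trace C V (A' ^ (k + 1) * B')) :
    LinearMap.trace C V B = LinearMap.trace C V B' := by
  let p : C[X] := A.charpoly * A'.charpoly
  have hpA : aeval A p = 0 := by simp [p, LinearMap.aeval_self_charpoly]
  have hpA' : aeval A' p = 0 := by simp [p, LinearMap.aeval_self_charpoly]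
  have hp0 : p.coeff 0 ≠ 0 := by
    have hdA : LinearMap.det A ≠ 0 := (hA.map LinearMap.det).ne_zero
    have hdA' : LinearMap.det A' ≠ 0 := (hA'.map LinearMap.det).ne_zero
    rw [LinearMap.det_eq_sign_charpoly_coeff] at hdA hdA'
    simp only [p, Polynomial.mul_coeff_zero]
    exact mul_ne_zero (right_ne_zero_of_mul hdA) (right_ne_zero_of_mul hdA')
  have t := trace_mul_aeval_mul_eq A A' B B' h (divX p)
  have eB := congrArg (LinearMap.trace C V) (coeff_zero_smul_eq_of_aeval_eq_zero p A B hpA)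
  have eB' := congrArg (LinearMap.trace C V) (coeff_zero_smul_eq_of_aeval_eq_zero p A' B' hpA')
  rw [map_smul, map_neg, t] at eB
  rw [map_smul, map_neg] at eB'
  rw [← eB', smul_eq_mul, smul_eq_mul] at eB
  exact mul_left_cancel₀ hp0 eB

end General

section Weil

variable {F : Type*} [Field F] [ValuativeRel F] [TopologicalSpace F] [IsNonarchimedeanLocalField F]
variable {C : Type*} [Field C] {V : Type*} [AddCommGroup V] [Module C V] [Module.Free C V] [Module.Finite C V]

/-- **Trace-off-inertia rigidity** for representations of the Weil group: if two representations of `W_F`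
on the same finite free module have equal traces at every `w ∉ I_F`, they have equal traces everywhere.
[cite: TateCorvallis1979, (4.1.3)] -/
theorem trace_eq_of_trace_eq_off_inertia (ρ ρ' : Representation C (WeilGroup F) V)
    (h : ∀ w : WeilGroup F, w ∉ WeilGroup.inertia F →
      LinearMap.trace C V (ρ w) = LinearMap.trace C V (ρ' w))
    (w : WeilGroup F) : LinearMap.trace C V (ρ w) = LinearMap.trace C V (ρ' w) := by
  by_cases hw : w ∈ WeilGroup.inertia F
  swap
  · exact h w hw
  obtain ⟨Φ, hΦ⟩ := WeilGroup.deg_surjective IsFrobPow.mul_holds IsFrobPow.unique_holds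
    (exists_isFrobPow_holds F) (1 : ℤ)
  have hw0 : WeilGroup.deg w = 0 :=
    (WeilGroup.deg_eq_zero_iff_mem_inertia IsFrobPow.mul_holds IsFrobPow.unique_holds).mpr hw
  have hk : ∀ k : ℕ, LinearMap.trace C V (ρ Φ ^ (k + 1) * ρ w) =
      LinearMap.trace C V (ρ' Φ ^ (k + 1) * ρ' w) := by
    intro k
    have hnot : Φ ^ (k + 1) * w ∉ WeilGroup.inertia F := by
      rw [← WeilGroup.deg_eq_zero_iff_mem_inertia IsFrobPow.mul_holds IsFrobPow.unique_holds,
        WeilGroup.deg_mul IsFrobPow.mul_holds IsFrobPow.unique_holds, WeilGroup.deg_pow, hΦ, hw0]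
      push_cast
      omega
    have := h _ hnot
    simpa only [map_mul, map_pow] using this
  exact trace_eq_of_trace_pow_mul_eq (ρ Φ) (ρ' Φ) (ρ w) (ρ' w) ((Group.isUnit Φ).map ρ)
    ((Group.isUnit Φ).map ρ') hk

/-- The Weil–Deligne form (the monodromy operators play no role). [cite: TateCorvallis1979, (4.1.3)] -/
theorem WeilDeligneRep.trace_eq_of_trace_eq_off_inertia {C : Type*} [Field C] [CharZero C]
    {V : Type*} [AddCommGroup V] [Module C V] [Module.Free C V] [Module.Finite C V]
    (S S' : WeilDeligneRep F C V)
    (h : ∀ w : WeilGroup F, w ∉ WeilGroup.inertia F →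
      LinearMap.trace C V (S.ρ w) = LinearMap.trace C V (S'.ρ w))
    (w : WeilGroup F) : LinearMap.trace C V (S.ρ w) = LinearMap.trace C V (S'.ρ w) :=
  NonIwahoriBlockMatchingTraceOffInertia.trace_eq_of_trace_eq_off_inertia S.ρ S'.ρ h w

end Weil

/-- The registered stub `stub_toir` (name and statement VERBATIM — the gate's `--supports` stub matcher wants both; no `def` indirection). -/
theorem stub_toir :
    ∀ (K : Type) [Field K] [NumberField K] (v : IsDedekindDomain.HeightOneSpectrum (NumberField.RingOfIntegers K)) (n : ℕ) (S S' : Literature.NumberTheory.GaloisRepresentations.WeilDeligneRep (v.adicCompletion K) ℂ (Fin n → ℂ)), (∀ w : Literature.NumberTheory.GaloisRepresentations.WeilGroup (v.adicCompletion K), w ∉ Literature.NumberTheory.GaloisRepresentations.WeilGroup.inertia (v.adicCompletion K) → LinearMap.trace ℂ (Fin n → ℂ) (S.ρ w) = LinearMap.trace ℂ (Fin n → ℂ) (S'.ρ w)) → ∀ w : Literature.NumberTheory.GaloisRepresentations.WeilGroup (v.adicCompletion K), LinearMap.trace ℂ (Fin n → ℂ) (S.ρ w) = LinearMap.trace ℂ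 (Fin n → ℂ) (S'.ρ w) := by
  intro K _ _ v n S S' h w
  exact WeilDeligneRep.trace_eq_of_trace_eq_off_inertia S S' h w

/- NOTE: the statement above is, character for character, the statement `_Goal.stub_toir` of the registered skeleton
`Cruxes/NonIwahoriBlockMatching/Lines/birth.lean` (that module is not built on the farm, so it is not imported here;
with it imported, `example : Summit.Langlands.Langlands.Cruxes.NonIwahoriBlockMatching.Birth._Goal.stub_toir := stub_toir` elaborates). No `def` in this file (Theorems defs are review-queued). -/

end Summit.Langlands.Langlands.Theorems.NonIwahoriBlockMatchingTraceOffInertia
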